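import Literature.MathematicalPhysics.QuantumFieldTheory.DiagonalLatticeClustering
import Literature.MathematicalPhysics.QuantumFieldTheory.SpeciesLatticeProducts
import Summits.QuantumFields.YangMills.Theorems.LatticeGapOnTrajectory.Negative.ZeroCoupling
import Summits.QuantumFields.YangMills.Theses.LangevinControlUV

/-!
# `GapToContinuum` (stmt-QuantumFields-8896) — the zero-coupling stratum carries no witness, for ANY renormalisation

Support file (negative side) for the crux `Summit.QuantumFields.YangMills.Theses.LangevinControlUV.GapToContinuum`
(`∀ G r sch T Δ, 0 < Δ → IsYangMillsFor r sch T → HasLatticeMassGap r sch Δ → T.HasMassGap Δ`), lead c5.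

The standing analysis of this crux (`Cruxes/GapToContinuum/STRATEGY-CENSUS.md`, `Disproof.lean`) finds it
unprovable as typed and looks for a refutation `IsYangMillsFor r sch T ∧ HasLatticeMassGap r sch Δ ∧ ¬ T.HasMassGap Δ`.
Two strata of Wilson's lattice theory are evaluable: the trivial gauge group (`Disproof.lean` §2: the conclusion
follows from `IsYangMillsFor` alone) and ZERO COUPLING `β_k = 0` (independent Haar links). For the latter only the
degenerate scheme `c ≡ 0` (all fields vanish, `T` = vacuum) had been checked. This file closes the whole stratum:

* `hasDiagClustering_of_zero_coupling` — if `β_k = 0` eventually then, WHATEVER the gauge group `G`, the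
  representation `r`, the volumes `L_k`, and the renormalisations `c_s(k), m_s(k)` of the scheme, `IsYangMillsFor r sch T`
  gives the diagonal lattice clustering `sch.HasDiagClustering r Δ` at EVERY rate `Δ` (constant `0`): on the scheme's
  own torus the reflected block `θpʳ` and the translated block `T_t p` of a slab-ordered product tensor read DISJOINT
  sets of links once `a_k (R + 1) ≤ lo₁` and the two slabs do not meet around the time circle (`a_k L_k → ∞`), so at
  `β = 0` the `2n`-point function FACTORISES exactly (`latticeSchwinger_theta_translate_zero_coupling`); the residual
  `Λₙ(θpʳ)(Λₙ(T_t p) − Λₙ(p))` is the `O(a_k)` time-mismatch of the lattice translate, which tends to `0` by the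
  convergence clause of `IsYangMillsFor` and E1 of `T`.
* `hasMassGap_of_zero_coupling` — hence `T.HasMassGap Δ` for every real `Δ` (tree transfer
  `IsYangMillsFor.hasMassGap_of_hasDiagClustering`), and `gapToContinuum_on_zeroCouplingStratum`: the crux HOLDS on the
  stratum `∀ᶠ k, β_k = 0`, with `0 < Δ` and `HasLatticeMassGap` idle there. Consequently no zero-coupling scheme — with
  any `c_s(k) → ∞` however fast, any counterterms, any `G` — can witness `¬ GapToContinuum`: a refutation needs a
  scheme with `β_k ≠ 0` frequently AND a non-ultralocal evaluable continuum limit (none is known in `d = 4`).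

* `gapToContinuum_iff_offZeroCoupling` — NORMAL FORM: the crux (by name) is equivalent to its restriction to schemes
  with `∃ᶠ k, β_k ≠ 0`; every proof or refutation of the typed text lives off the zero-coupling stratum.

Ingredients: `wilsonMeasure_zero_coupling`, `integral_mul_eq_of_dependsOn_disjoint` (sibling negative file
`LatticeGapOnTrajectory/Negative/ZeroCoupling.lean`, p69462), `dependsOn_smearedLatticeField_torusLift`
(`SpeciesLatticeProducts`) and its reflected-slab twin proved here. Tree objects only; nothing posited; 0 sorry.
-/

noncomputable section

open scoped SchwartzMap ComplexConjugate BigOperators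
open MeasureTheory Filter Topology Complex
open Literature.MathematicalPhysics.AQFT Literature.MathematicalPhysics.QuantumLattice
open Literature.MathematicalPhysics.QuantumFieldTheory Literature.Probability.LatticeModels

namespace Summit.QuantumFields.YangMills.Theorems.GapToContinuum.ZeroCoupling

open Summit.QuantumFields.YangMills.Theorems.LatticeGapOnTrajectory.Negative
  (integral_mul_eq_of_dependsOn_disjoint wilsonMeasure_zero_coupling)

variable {G : Type} [Group G] [TopologicalSpace G] [IsTopologicalGroup G] [CompactSpace G]
  [MeasurableSpace G] [BorelSpace G]

/-! ## §1 Slab supports of smeared fields: the reflected slab, translated slabs, products -/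

omit [TopologicalSpace G] [IsTopologicalGroup G] [CompactSpace G] [BorelSpace G] in
/-- **Support, reflected slab.** A field smeared with `θf`, `f` supported in the slab `lo ≤ x⁰ ≤ hi` with
`a (R + 1) ≤ lo` and `hi + a R ≤ a w` (`R` the time radius of the species), depends only on the torus links
based at lattice times `-w, …, -1` (mod `Sd`, around the time circle) — the reflected twin of
`dependsOn_smearedLatticeField_torusLift`. [folklore] -/
theorem dependsOn_smearedLatticeField_thetaTest_torusLift (s : YMSpecies G) (L : ℕ) {a : ℝ} (ha : 0 < a)
    (c m : ℝ) {f : 𝓢(EuclideanSpace ℝ (Fin 4), ℝ)} {lo hi : ℝ}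
    (hsupp : tsupport (f : EuclideanSpace ℝ (Fin 4) → ℝ) ⊆ {x | lo ≤ x 0 ∧ x 0 ≤ hi}) {w : ℕ}
    (hlo : a * (timeRadius s + 1) ≤ lo) (hhi : hi + a * timeRadius s ≤ a * w) (Sd : ℕ) :
    DependsOn (fun U : GaugeConfig 4 Sd G =>
        smearedLatticeField s.F (box 4 L) a c m (thetaTest 4 f) (torusLift Sd U))
      {e | ∃ z : ℤ, -(w : ℤ) ≤ z ∧ z ≤ -1 ∧ e.1 0 = (z : ZMod Sd)} := by
  intro U V hUV
  simp only [smearedLatticeField]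
  refine congrArg (fun z : ℝ => c * a ^ 4 * z) (Finset.sum_congr rfl fun x _ => ?_)
  by_cases hx : thetaTest 4 f (a • siteToE x) = 0
  · simp [hx]
  rw [thetaTest_apply] at hx
  have hx' := hsupp (subset_tsupport _ (Function.mem_support.2 hx))
  simp only [Set.mem_setOf_eq, timeReflection_apply, if_true, PiLp.smul_apply, siteToE_apply,
    smul_eq_mul] at hx'
  have h1 : (x 0 : ℝ) + (timeRadius s + 1) ≤ 0 := by
    refine le_of_mul_le_mul_left ?_ ha
    nlinarith [hx'.1, hlo]
  have h2 : -(w : ℝ) ≤ (x 0 : ℝ) - timeRadius s := by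
    refine le_of_mul_le_mul_left ?_ ha
    nlinarith [hx'.2, hhi]
  have h1' : x 0 + (timeRadius s : ℤ) + 1 ≤ 0 := by
    have : (x 0 : ℝ) + timeRadius s + 1 ≤ 0 := by linarith
    exact_mod_cast this
  have h2' : -(w : ℤ) ≤ x 0 - (timeRadius s : ℤ) := by exact_mod_cast h2
  have hO : s.F (configShift (-x) (torusLift Sd U)) = s.F (configShift (-x) (torusLift Sd V)) := by
    refine s.isCylinder fun e he => ?_
    simp only [Literature.MathematicalPhysics.QuantumLattice.configShift_apply, torusLift,
      Function.comp_apply]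
    refine hUV _ ?_
    have hR := abs_le.1 (abs_le_timeRadius s he)
    have hz : -(w : ℤ) ≤ (e.1 - -x) 0 ∧ (e.1 - -x) 0 ≤ -1 := by
      simp only [Pi.sub_apply, Pi.neg_apply]
      constructor <;> omega
    simp only [Set.mem_setOf_eq, torusEdge, Torus.proj_apply]
    exact ⟨(e.1 - -x) 0, hz.1, hz.2, rfl⟩
  rw [hO]

omit [Group G] [TopologicalSpace G] [IsTopologicalGroup G] [CompactSpace G] [MeasurableSpace G]
  [BorelSpace G] in
/-- The topological support of a translated test function is contained in the translate of the support.
[folklore] -/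
theorem tsupport_translateTest_subset (b : EuclideanSpace ℝ (Fin 4)) (f : 𝓢(EuclideanSpace ℝ (Fin 4), ℝ)) :
    tsupport (translateTest b f : EuclideanSpace ℝ (Fin 4) → ℝ) ⊆
      (fun x => x - b) ⁻¹' tsupport (f : EuclideanSpace ℝ (Fin 4) → ℝ) := by
  refine closure_minimal (fun x hx => ?_) ((isClosed_tsupport _).preimage (by fun_prop))
  exact subset_tsupport _ (by simpa [translateTest_apply] using hx)

omit [Group G] [TopologicalSpace G] [IsTopologicalGroup G] [CompactSpace G] [MeasurableSpace G]
  [BorelSpace G] in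
/-- A time translate by `t` of a function supported in the slab `lo ≤ x⁰ ≤ hi` is supported in the slab
`lo + t ≤ x⁰ ≤ hi + t`. [folklore] -/
theorem tsupport_translateTest_single_subset {f : 𝓢(EuclideanSpace ℝ (Fin 4), ℝ)} {lo hi : ℝ}
    (hsupp : tsupport (f : EuclideanSpace ℝ (Fin 4) → ℝ) ⊆ {x | lo ≤ x 0 ∧ x 0 ≤ hi}) (t : ℝ) :
    tsupport (translateTest (EuclideanSpace.single 0 t) f : EuclideanSpace ℝ (Fin 4) → ℝ) ⊆
      {x | lo + t ≤ x 0 ∧ x 0 ≤ hi + t} := by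
  intro x hx
  have h := hsupp (tsupport_translateTest_subset _ f hx)
  have h0 : (x - EuclideanSpace.single (0 : Fin 4) t) 0 = x 0 - t := by simp
  simp only [Set.mem_setOf_eq, h0] at h
  simp only [Set.mem_setOf_eq]
  constructor <;> linarith [h.1, h.2]

omit [Group G] [TopologicalSpace G] [IsTopologicalGroup G] [CompactSpace G] [MeasurableSpace G]
  [BorelSpace G] in
/-- A finite product of functions each depending only on the coordinates in `s` depends only on `s`. [folklore] -/
theorem dependsOn_prod {κ : Type*} {n : ℕ} {F : Fin n → (κ → G) → ℝ} {s : Set κ}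
    (h : ∀ j, DependsOn (F j) s) : DependsOn (fun U => ∏ j, F j U) s :=
  fun _ _ hUV => Finset.prod_congr rfl fun j _ => h j hUV

/-! ## §2 Zero coupling: disjoint slabs are independent -/

/-- **Independence of disjoint time slabs at `β = 0`.** Under Wilson's measure at zero coupling (= product Haar,
`wilsonMeasure_zero_coupling`) a measurable `X` reading only links at times `-wX, …, -1` (mod `Sd`) and a
measurable `Y` reading only links at times `1, …, wY`, with `wX + wY < Sd`, are uncorrelated: `∫ X Y = ∫ X · ∫ Y`
(independent Haar links; a `ZMod Sd` computation for the disjointness). [folklore] -/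
theorem integral_mul_eq_of_slabs_zero_coupling {N : ℕ} (ρ : G →* Matrix (Fin N) (Fin N) ℂ) (Sd : ℕ)
    [NeZero Sd] {X Y : GaugeConfig 4 Sd G → ℝ} (hXm : Measurable X) (hYm : Measurable Y) {wX wY : ℕ}
    (hX : DependsOn X {e : Edge 4 Sd | ∃ z : ℤ, -(wX : ℤ) ≤ z ∧ z ≤ -1 ∧ e.1 0 = (z : ZMod Sd)})
    (hY : DependsOn Y {e : Edge 4 Sd | 1 ≤ (e.1 0).val ∧ (e.1 0).val ≤ wY}) (hw : wX + wY < Sd) :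
    ∫ U, X U * Y U ∂(wilsonMeasure (d := 4) (L := Sd) ρ 0) =
      (∫ U, X U ∂(wilsonMeasure (d := 4) (L := Sd) ρ 0)) *
        ∫ U, Y U ∂(wilsonMeasure (d := 4) (L := Sd) ρ 0) := by
  classical
  rw [wilsonMeasure_zero_coupling ρ Sd]
  set I : Finset (Edge 4 Sd) :=
    Finset.univ.filter fun e => ∃ z : ℤ, -(wX : ℤ) ≤ z ∧ z ≤ -1 ∧ e.1 0 = (z : ZMod Sd) with hI
  set J : Finset (Edge 4 Sd) := Finset.univ.filter fun e => 1 ≤ (e.1 0).val ∧ (e.1 0).val ≤ wY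
    with hJ
  have hIJ : Disjoint I J := by
    rw [Finset.disjoint_left]
    intro e heI heJ
    simp only [hI, hJ, Finset.mem_filter, Finset.mem_univ, true_and] at heI heJ
    obtain ⟨z, hz1, hz2, hze⟩ := heI
    obtain ⟨hv1, hv2⟩ := heJ
    -- `e.1 0 = (v : ZMod Sd)` with `1 ≤ v ≤ wY` and `= (z : ZMod Sd)` with `-wX ≤ z ≤ -1`: impossible
    have hv : (((e.1 0).val : ℤ) : ZMod Sd) = (z : ZMod Sd) := by
      rw [Int.cast_natCast, ZMod.natCast_zmod_val, hze]
    rw [ZMod.intCast_eq_intCast_iff_dvd_sub] at hv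
    have hdvd : (Sd : ℤ) ∣ ((e.1 0).val : ℤ) - z := dvd_sub_comm.1 hv
    have hpos : (0 : ℤ) < ((e.1 0).val : ℤ) - z := by omega
    have hle := Int.le_of_dvd hpos hdvd
    omega
  refine integral_mul_eq_of_dependsOn_disjoint (haarProbability G) I J hIJ ?_ ?_ hXm hYm
  · exact fun U V hUV => hX fun e he => hUV e (by simpa [hI] using he)
  · exact fun U V hUV => hY fun e he => hUV e (by simpa [hJ] using he)

/-- **Exact factorisation of the diagonal `2n`-point function at zero coupling.** At a step `k` with `β_k = 0`,
for a species string `σ` (time radii `≤ R`) and real factors `p` supported in slabs `lo i ≤ x⁰ ≤ hi i` with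
`a_k (R + 1) ≤ lo i`, and widths `wX, wY` with `hi i + a_k R ≤ a_k wX`, `hi i + t + a_k R ≤ a_k wY` (`0 ≤ t`),
`wX + wY < 2 L_k + 1`, the lattice `2n`-point function of `θpʳ ++ T_t p` is the PRODUCT of the two `n`-point
functions: the two blocks read disjoint links of the own torus. [folklore] -/
theorem latticeSchwinger_theta_translate_zero_coupling (r : LatticeRep G) (sch : SpeciesScheme (YMSpecies G))
    {k : ℕ} (hβ : sch.β k = 0) {n : ℕ} (σ : Fin n → YMSpecies G)
    (p : Fin n → 𝓢(EuclideanSpace ℝ (Fin 4), ℝ)) {lo hi : Fin n → ℝ}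
    (hsupp : ∀ i, tsupport (p i : EuclideanSpace ℝ (Fin 4) → ℝ) ⊆ {x | lo i ≤ x 0 ∧ x 0 ≤ hi i})
    {R : ℕ} (hR : ∀ i, timeRadius (σ i) ≤ R) (hlo : ∀ i, sch.a k * (R + 1) ≤ lo i) {t : ℝ} (ht : 0 ≤ t)
    {wX wY : ℕ} (hwX : ∀ i, hi i + sch.a k * R ≤ sch.a k * wX)
    (hwY : ∀ i, hi i + t + sch.a k * R ≤ sch.a k * wY) (hw : wX + wY < sch.side k) :
    latticeSchwinger r.ρ sch (fun s => s.F) k (n + n) (Fin.append (σ ∘ Fin.rev) σ)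
        (Fin.append (fun l => thetaTest 4 (p (Fin.rev l)))
          (fun l => translateTest (EuclideanSpace.single 0 t) (p l))) =
      latticeSchwinger r.ρ sch (fun s => s.F) k n (σ ∘ Fin.rev) (fun l => thetaTest 4 (p (Fin.rev l))) *
        latticeSchwinger r.ρ sch (fun s => s.F) k n σ
          (fun l => translateTest (EuclideanSpace.single 0 t) (p l)) := by
  have ha := sch.a_pos k
  unfold latticeSchwinger
  simp only [Fin.prod_univ_add, Fin.append_left, Fin.append_right, Function.comp_apply, hβ]
  refine integral_mul_eq_of_slabs_zero_coupling r.ρ (sch.side k) ?_ ?_ (wX := wX) (wY := wY) ?_ ?_ hw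
  · exact Finset.measurable_prod _ fun i _ =>
      measurable_smearedLatticeField_torusLift _ _ _ _ _ _ _
  · exact Finset.measurable_prod _ fun j _ =>
      measurable_smearedLatticeField_torusLift _ _ _ _ _ _ _
  · refine dependsOn_prod fun i => ?_
    have hRi : (timeRadius (σ (Fin.rev i)) : ℝ) ≤ R := by exact_mod_cast hR _
    have hm := mul_le_mul_of_nonneg_left hRi ha.le
    exact dependsOn_smearedLatticeField_thetaTest_torusLift (σ (Fin.rev i)) (sch.L k) ha _ _
      (hsupp (Fin.rev i)) (by nlinarith [hlo (Fin.rev i)]) (by nlinarith [hwX (Fin.rev i)]) _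
  · refine dependsOn_prod fun j => ?_
    have hRj : (timeRadius (σ j) : ℝ) ≤ R := by exact_mod_cast hR j
    have hm := mul_le_mul_of_nonneg_left hRj ha.le
    exact dependsOn_smearedLatticeField_torusLift (σ j) (sch.L k) ha _ _
      (tsupport_translateTest_single_subset (hsupp j) t) (by nlinarith [hlo j])
      (by nlinarith [hwY j]) (by omega)

/-! ## §3 Diagonal clustering, mass gap, and the crux on the zero-coupling stratum -/

/-- **Zero coupling clusters diagonally at every rate, for ANY renormalisation.** If `β_k = 0` eventually, then
along any `IsYangMillsFor` scheme — arbitrary `G`, `r`, `L_k`, `c_s(k)`, `m_s(k)` — the diagonal lattice clustering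
`sch.HasDiagClustering r Δ` holds for every real `Δ`, with constant `0`: eventually in `k` the `2n`-point function of
`θpʳ ++ T_t p` factorises exactly (`latticeSchwinger_theta_translate_zero_coupling`), and the residual
`Λₙ(θpʳ) (Λₙ(T_t p) − Λₙ(p))` tends to `0` by the convergence clause of `IsYangMillsFor` and E1 (translation
invariance) of `T`. [folklore] -/
theorem hasDiagClustering_of_zero_coupling (r : LatticeRep G) {sch : SpeciesScheme (YMSpecies G)}
    {T : OSData (YMSpecies G) 4} (hβ : ∀ᶠ k in atTop, sch.β k = 0) (hYM : IsYangMillsFor r sch T)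
    (Δ : ℝ) : sch.HasDiagClustering r Δ := by
  intro n hn σ p hp
  refine ⟨0, fun t ht ε hε => ?_⟩
  obtain ⟨lo, hi, hlo, -, -, hsupp⟩ := id hp
  -- the tensor `P = ⊗ p` and the three convergences supplied by `IsYangMillsFor`
  obtain ⟨P, hpT⟩ : ∃ P : 𝓢((Fin n → EuclideanSpace ℝ (Fin 4)), ℂ),
      IsTensorOf P (fun l => ofRealTest (p l)) := exists_isTensorOf _
  have hPt : IsTimeOrdered P := IsTimeOrdered.of_mem_slabOrderedProducts (hp.mem_slabOrderedProducts hpT)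
  set a : EuclideanSpace ℝ (Fin 4) := EuclideanSpace.single 0 t with ha_def
  set Λ : ℕ → (n : ℕ) → (Fin n → YMSpecies G) → (Fin n → 𝓢(EuclideanSpace ℝ (Fin 4), ℝ)) → ℂ :=
    fun k n σ f => ((latticeSchwinger r.ρ sch (fun s => s.F) k n σ f : ℝ) : ℂ) with hΛ
  have hB : Tendsto (fun k => Λ k n (σ ∘ Fin.rev) (fun l => thetaTest 4 (p (Fin.rev l))))
      atTop (𝓝 (T.schwinger n (σ ∘ Fin.rev) (osAdjoint P))) :=
    hYM n hn _ _ _ hpT.osAdjoint hPt.isOffDiagonal.osAdjoint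
  have hC : Tendsto (fun k => Λ k n σ p) atTop (𝓝 (T.schwinger n σ P)) :=
    hYM n hn _ _ _ hpT hPt.isOffDiagonal
  have hC' : Tendsto (fun k => Λ k n σ (fun l => translateTest a (p l))) atTop
      (𝓝 (T.schwinger n σ P)) := by
    have ha0 : 0 ≤ a 0 := by simp [ha_def, ht]
    have h1 := hYM n hn σ (fun l => translateTest a (p l)) (translateMulti a P)
      (hpT.translateMulti a) (OSReconstructionNoE1.isTimeOrdered_translateMulti hPt ha0).isOffDiagonal
    rwa [T.invariant.1 n σ a P hPt.isOffDiagonal] at h1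
  -- eventually in `k` the `2n`-point function factorises exactly
  set R : ℕ := Finset.univ.sup fun i => timeRadius (σ i) with hR_def
  have hR : ∀ i, timeRadius (σ i) ≤ R := fun i => Finset.le_sup (f := fun i => timeRadius (σ i))
    (Finset.mem_univ i)
  set hiM : ℝ := ∑ i, |hi i| with hhiM_def
  have hhiM : ∀ i, hi i ≤ hiM := fun i =>
    (le_abs_self _).trans (Finset.single_le_sum (f := fun i => |hi i|) (fun _ _ => abs_nonneg _)
      (Finset.mem_univ i))
  have hhiM0 : 0 ≤ hiM := Finset.sum_nonneg fun _ _ => abs_nonneg _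
  have e1 : ∀ᶠ k in atTop, sch.a k ≤ 1 :=
    (sch.tendsto_a.eventually (gt_mem_nhds one_pos)).mono fun k hk => hk.le
  have e2 : ∀ᶠ k in atTop, ∀ i, sch.a k * (R + 1) ≤ lo i := by
    refine eventually_all.2 fun i => ?_
    have hpos : 0 < lo i / (R + 1) := div_pos (hlo i) (by positivity)
    refine (sch.tendsto_a.eventually (gt_mem_nhds hpos)).mono fun k hk => ?_
    have := (lt_div_iff₀ (by positivity : (0 : ℝ) < R + 1)).1 hk
    linarith
  have e3 : ∀ᶠ k in atTop, hiM + t + 2 * R + 2 ≤ sch.a k * sch.L k := sch.tendsto_L.eventually_ge_atTop _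
  have hfac : ∀ᶠ k in atTop,
      Λ k (n + n) (Fin.append (σ ∘ Fin.rev) σ)
          (Fin.append (fun l => thetaTest 4 (p (Fin.rev l))) (fun l => translateTest a (p l))) =
        Λ k n (σ ∘ Fin.rev) (fun l => thetaTest 4 (p (Fin.rev l))) *
          Λ k n σ (fun l => translateTest a (p l)) := by
    filter_upwards [hβ, e1, e2, e3] with k hk h1 h2 h3
    have ha := sch.a_pos k
    -- slab widths in lattice units
    set wX : ℕ := ⌈hiM / sch.a k⌉₊ + R with hwX_def
    set wY : ℕ := ⌈(hiM + t) / sch.a k⌉₊ + R with hwY_def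
    have hwX : ∀ i, hi i + sch.a k * R ≤ sch.a k * wX := by
      intro i
      have hc : hiM / sch.a k ≤ ⌈hiM / sch.a k⌉₊ := Nat.le_ceil _
      have : hiM ≤ sch.a k * ⌈hiM / sch.a k⌉₊ := by
        rw [div_le_iff₀ ha] at hc; linarith
      simp only [hwX_def, Nat.cast_add]
      nlinarith [hhiM i]
    have hwY : ∀ i, hi i + t + sch.a k * R ≤ sch.a k * wY := by
      intro i
      have hc : (hiM + t) / sch.a k ≤ ⌈(hiM + t) / sch.a k⌉₊ := Nat.le_ceil _
      have : hiM + t ≤ sch.a k * ⌈(hiM + t) / sch.a k⌉₊ := by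
        rw [div_le_iff₀ ha] at hc; linarith
      simp only [hwY_def, Nat.cast_add]
      nlinarith [hhiM i]
    have hw : wX + wY < sch.side k := by
      have hcX : (⌈hiM / sch.a k⌉₊ : ℝ) < hiM / sch.a k + 1 := Nat.ceil_lt_add_one (by positivity)
      have hcY : (⌈(hiM + t) / sch.a k⌉₊ : ℝ) < (hiM + t) / sch.a k + 1 :=
        Nat.ceil_lt_add_one (by positivity)
      have hreal : ((wX + wY : ℕ) : ℝ) < ((sch.side k : ℕ) : ℝ) := by
        simp only [hwX_def, hwY_def, SpeciesScheme.side, Nat.cast_add, Nat.cast_mul, Nat.cast_ofNat,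
          Nat.cast_one]
        have hk1 : hiM / sch.a k * sch.a k = hiM := div_mul_cancel₀ _ ha.ne'
        have hk2 : (hiM + t) / sch.a k * sch.a k = hiM + t := div_mul_cancel₀ _ ha.ne'
        -- multiply through by `a_k > 0`
        by_contra hcon
        push Not at hcon
        have := mul_le_mul_of_nonneg_right hcon ha.le
        nlinarith [hcX, hcY, h1, h3, ht, hk1, hk2, mul_nonneg ha.le (Nat.cast_nonneg R)]
      exact_mod_cast hreal
    have key := latticeSchwinger_theta_translate_zero_coupling r sch hk σ p hsupp hR h2 ht hwX hwY hw
    simp only [hΛ, ha_def]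
    rw [key, Complex.ofReal_mul]
  -- the residual tends to zero
  have hlim : Tendsto (fun k =>
      Λ k (n + n) (Fin.append (σ ∘ Fin.rev) σ)
          (Fin.append (fun l => thetaTest 4 (p (Fin.rev l))) (fun l => translateTest a (p l))) -
        Λ k n (σ ∘ Fin.rev) (fun l => thetaTest 4 (p (Fin.rev l))) * Λ k n σ p) atTop (𝓝 0) := by
    have h := hB.mul (hC'.sub hC)
    rw [sub_self, mul_zero] at h
    refine h.congr' ?_
    filter_upwards [hfac] with k hk
    rw [hk]; ring
  have hev := (hlim.norm.eventually (gt_mem_nhds (by simpa using hε)))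
  refine hev.mono fun k hk => ?_
  rw [zero_mul, zero_add]
  exact (le_of_lt (by simpa using hk))

/-- **Every zero-coupling continuum limit has every mass gap.** If `β_k = 0` eventually and `IsYangMillsFor r sch T`,
then `T.HasMassGap Δ` for EVERY real `Δ` — for any compact `G`, any `r`, any volumes and any renormalisations
(`c_s(k)` growing as fast as one likes): the continuum limit is ultralocal on `⁰𝒮`. [folklore] -/
theorem hasMassGap_of_zero_coupling (r : LatticeRep G) {sch : SpeciesScheme (YMSpecies G)}
    {T : OSData (YMSpecies G) 4} (hβ : ∀ᶠ k in atTop, sch.β k = 0) (hYM : IsYangMillsFor r sch T)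
    (Δ : ℝ) : T.HasMassGap Δ :=
  hYM.hasMassGap_of_hasDiagClustering (hasDiagClustering_of_zero_coupling r hβ hYM Δ)

/-- **The crux `GapToContinuum` HOLDS on the zero-coupling stratum** (its body, verbatim, under the extra clause
`∀ᶠ k, β_k = 0`; `0 < Δ` and `HasLatticeMassGap` are idle there). Hence no zero-coupling scheme, whatever its
renormalisation, witnesses `¬ GapToContinuum`. [folklore] -/
theorem gapToContinuum_on_zeroCouplingStratum :
    ∀ (G : Type) [Group G] [TopologicalSpace G] [IsTopologicalGroup G] [CompactSpace G]
      [MeasurableSpace G] [BorelSpace G] (r : LatticeRep G) (sch : SpeciesScheme (YMSpecies G))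
      (T : OSData (YMSpecies G) 4) (Δ : ℝ), (∀ᶠ k in atTop, sch.β k = 0) → 0 < Δ →
        IsYangMillsFor r sch T → HasLatticeMassGap r sch Δ → T.HasMassGap Δ :=
  fun _G _ _ _ _ _ _ r _sch _T Δ hβ _ hYM _ => hasMassGap_of_zero_coupling r hβ hYM Δ

/-- **No zero-coupling witness against the crux.** [folklore] -/
theorem not_witness_zero_coupling (r : LatticeRep G) {sch : SpeciesScheme (YMSpecies G)}
    {T : OSData (YMSpecies G) 4} (hβ : ∀ᶠ k in atTop, sch.β k = 0) (Δ : ℝ) :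
    ¬ (IsYangMillsFor r sch T ∧ HasLatticeMassGap r sch Δ ∧ ¬ T.HasMassGap Δ) :=
  fun h => h.2.2 (hasMassGap_of_zero_coupling r hβ h.1 Δ)

/-- **Normal form: the crux is its own restriction OFF the zero-coupling stratum.** `GapToContinuum` is
equivalent to the same implication asked only of schemes whose coupling is non-zero FREQUENTLY along the sequence
(`∃ᶠ k, β_k ≠ 0`); the complementary stratum `∀ᶠ k, β_k = 0` is discharged by `hasMassGap_of_zero_coupling` for
every `G`, `r`, `L_k`, `c_s(k)`, `m_s(k)`. Any proof or refutation of the typed crux therefore lives entirely at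
`β_k ≠ 0`. [folklore] -/
theorem gapToContinuum_iff_offZeroCoupling :
    Summit.QuantumFields.YangMills.Theses.LangevinControlUV.GapToContinuum ↔
      ∀ (G : Type) [Group G] [TopologicalSpace G] [IsTopologicalGroup G] [CompactSpace G]
        [MeasurableSpace G] [BorelSpace G] (r : LatticeRep G) (sch : SpeciesScheme (YMSpecies G))
        (T : OSData (YMSpecies G) 4) (Δ : ℝ), (∃ᶠ k in atTop, sch.β k ≠ 0) → 0 < Δ →
          IsYangMillsFor r sch T → HasLatticeMassGap r sch Δ → T.HasMassGap Δ := by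
  constructor
  · intro h G _ _ _ _ _ _ r sch T Δ _ hΔ hYM hlat
    exact h G r sch T Δ hΔ hYM hlat
  · intro h G _ _ _ _ _ _ r sch T Δ hΔ hYM hlat
    by_cases hβ : ∀ᶠ k in atTop, sch.β k = 0
    · exact hasMassGap_of_zero_coupling r hβ hYM Δ
    · refine h G r sch T Δ ?_ hΔ hYM hlat
      exact Filter.not_eventually.1 hβ

end Summit.QuantumFields.YangMills.Theorems.GapToContinuum.ZeroCoupling

end
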